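import Mathlib
import Summits.MatrixMultiplication.Statement
import Summits.MatrixMultiplication.MatrixMultiplication.Theorems.GraphEquationsPureForms
import Summits.MatrixMultiplication.MatrixMultiplication.Theorems.GraphEquationsIsotropicKernel

/-!
# Graph equations — `IsolatedForcesRank` for QUADRATIC forms and the first multiplicity-2 rung (M69)

Decomp-mm node «GraphEquations» (lens 5, g42); attacked leaf `MultiplicityReduction`
(stmt-MatrixMultiplication-27806).  Target VERBATIM: `_root_.MatrixMultiplication`.  Route-neutral.

After `ω₃ = ω` (M66/M68) the crux is `[ω ≤ ω_v]`: correct systems of TEST DEGREE `≥ 4`.  Degree `4`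
is the first rung where MULTIPLICITY appears — `I(W_n)² ∩ ℂ[A,B,C]_{≤3} = 0`, but the quartic system
`{f_q²}` is correct and kills every Jacobian engine (all its horizontal derivatives vanish: `X_v f_q = 0`).
The tree's answer to multiplicity is the initial-form engine of M8/M9a
(`GraphEquationsInitialForms`, `GraphEquationsPureForms`): pure initial forms `P_o(f)` with a
full-rank gradient matrix `(∂P_o/∂F_q)(γ)` at SOME `γ` force `ω ≤ β`, and the commutative-algebra
statement `IsolatedForcesRank` («an isolated fibre forces generic Jacobian rank `n²`») is NAMED, not
proved.

This file PROVES `IsolatedForcesRank` for homogeneous QUADRATIC maps `P_o(F) = ⟨a_o F, F⟩`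
(`isolatedForcesRank_matQuadPoly`) — by the isotropic kernel lemma of M66
(`isotropicKernelLemma_all`): if every gradient matrix `G(γ) = ((a_o + a_oᵀ)γ)_o` had a kernel
vector, then `∀ γ ≠ 0 ∃ ξ ≠ 0 ∀ o, ⟨(a_o + a_oᵀ)γ, ξ⟩ = 0`, so some `x ≠ 0` is isotropic for all
`a_o`, contradicting isolation.  Consequences (unconditional):

* `EqSystem.PureQuadIsolatedAt` — pure QUADRATIC isolated initial forms of order `≤ K` at a graph
  point — implies `InitNondegAt` (`initNondegAt_of_pureQuadIsolatedAt`), hence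
  `R(⟨n,n,n⟩) ≤ 2K²·cost` (`tensorRank_le_of_pureQuadIsolatedAt`);
* **`omega_le_of_eqAdmissiblePureQuad`** — cheap correct systems with pure quadratic isolated initial
  forms force `ω ≤ β`: the multiplicity-2 analogue of the reduced rung, covering e.g. `{f_q²}` and every
  `{a_o(f,f)}_o` whose quadrics have no common nonzero zero.
-/

set_option linter.dupNamespace false

noncomputable section

namespace Summit.MatrixMultiplication.MatrixMultiplication.Theorems.GraphEquations

open MvPolynomial Matrix Literature.Computability.AlgebraicComplexity

/-! ## Quadratic forms as polynomials -/

section Quad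

variable {ι : Type} [Fintype ι]

/-- The quadratic form `F ↦ ⟨F, a F⟩` of a square matrix, as a polynomial. -/
def matQuadPoly (a : Matrix ι ι ℂ) : MvPolynomial ι ℂ := ∑ q, ∑ q', C (a q q') * X q * X q'

/-- `matQuadPoly a` evaluates to `F ⬝ᵥ (a *ᵥ F)`. -/
theorem eval_matQuadPoly (a : Matrix ι ι ℂ) (F : ι → ℂ) :
    eval F (matQuadPoly a) = F ⬝ᵥ (a *ᵥ F) := by
  simp only [matQuadPoly, map_sum, map_mul, eval_C, eval_X, dotProduct, mulVec, Finset.mul_sum]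
  exact Finset.sum_congr rfl fun q _ => Finset.sum_congr rfl fun q' _ => by ring

/-- `matQuadPoly a` vanishes at `0`. -/
theorem eval_zero_matQuadPoly (a : Matrix ι ι ℂ) : eval 0 (matQuadPoly a) = 0 := by
  rw [eval_matQuadPoly]; simp

/-- The partial derivative `∂/∂F_q ⟨F, aF⟩` evaluated at `γ` is `((a + aᵀ)γ)_q`. -/
theorem eval_pderiv_matQuadPoly [DecidableEq ι] (a : Matrix ι ι ℂ) (γ : ι → ℂ) (q : ι) :
    eval γ (pderiv q (matQuadPoly a)) = ((a + aᵀ) *ᵥ γ) q := by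
  have hX : ∀ j : ι, eval γ (pderiv q (X j : MvPolynomial ι ℂ)) = if j = q then 1 else 0 := by
    intro j
    rw [pderiv_X]
    by_cases h : j = q
    · subst h; simp
    · simp [h]
  simp only [matQuadPoly, map_sum, pderiv_mul, pderiv_C, zero_mul, zero_add, map_add, map_mul,
    eval_C, eval_X, hX, mulVec, dotProduct, Matrix.add_apply, transpose_apply, add_mul]
  simp_rw [Finset.sum_add_distrib]
  rw [Finset.sum_comm]
  simp only [mul_ite, ite_mul, mul_one, mul_zero, zero_mul, Finset.sum_ite_eq', Finset.mem_univ,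
    if_true]

end Quad

/-! ## `IsolatedForcesRank` for quadratic maps -/

/-- The gradient matrix of a family of quadratic forms acts by `ξ ↦ (⟨(a_o + a_oᵀ)γ, ξ⟩)_o`. -/
theorem gradMatrix_matQuadPoly_mulVec {n T : ℕ} (a : Fin T → Matrix (Fin n × Fin n) (Fin n × Fin n) ℂ)
    (γ ξ : Fin n × Fin n → ℂ) (o : Fin T) :
    (gradMatrix γ (fun o => matQuadPoly (a o)) *ᵥ ξ) o = ((a o + (a o)ᵀ) *ᵥ γ) ⬝ᵥ ξ := by
  simp only [gradMatrix, mulVec, dotProduct, Matrix.of_apply, eval_pderiv_matQuadPoly]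

/-- **`IsolatedForcesRank` for homogeneous quadratic maps** (via the isotropic kernel lemma). -/
theorem isolatedForcesRank_matQuadPoly (n T : ℕ) (a : Fin T → Matrix (Fin n × Fin n) (Fin n × Fin n) ℂ)
    (hiso : ∀ F₀ : Fin n × Fin n → ℂ,
      (∀ o, eval F₀ (matQuadPoly (a o)) = eval 0 (matQuadPoly (a o))) → F₀ = 0) :
    ∃ γ : Fin n × Fin n → ℂ, (gradMatrix γ (fun o => matQuadPoly (a o))).rank = n * n := by
  classical
  set P : Fin T → MvPolynomial (Fin n × Fin n) ℂ := fun o => matQuadPoly (a o) with hP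
  -- some gradient matrix has trivial kernel
  suffices h : ∃ γ : Fin n × Fin n → ℂ, Function.Injective (gradMatrix γ P).mulVecLin by
    obtain ⟨γ, hγ⟩ := h
    refine ⟨γ, ?_⟩
    rw [Matrix.rank, LinearMap.finrank_range_of_inj hγ, Module.finrank_fintype_fun_eq_card,
      Fintype.card_prod, Fintype.card_fin]
  by_contra hcon
  rw [not_exists] at hcon
  have hker : ∀ γ : Fin n × Fin n → ℂ, ∃ ξ : Fin n × Fin n → ℂ, ξ ≠ 0 ∧
      ∀ o, ((a o + (a o)ᵀ) *ᵥ γ) ⬝ᵥ ξ = 0 := by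
    intro γ
    have h := hcon γ
    rw [← LinearMap.ker_eq_bot, Submodule.eq_bot_iff] at h
    obtain ⟨ξ, hξ, hne⟩ : ∃ ξ, ξ ∈ LinearMap.ker (gradMatrix γ P).mulVecLin ∧ ξ ≠ 0 := by
      by_contra h'
      exact h fun ξ hξ => by_contra fun hne => h' ⟨ξ, hξ, hne⟩
    refine ⟨ξ, hne, fun o => ?_⟩
    have := congrFun (LinearMap.mem_ker.mp hξ) o
    rwa [Matrix.mulVecLin_apply, gradMatrix_matQuadPoly_mulVec] at this
  -- the case `n = 0` is trivial; otherwise apply ISO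
  rcases Nat.eq_zero_or_pos n with hn | hn
  · subst hn
    refine hcon 0 fun ξ ξ' _ => ?_
    funext q; exact Fin.elim0 q.1
  let V := Fin n × Fin n → ℂ
  let b : Fin T → V →ₗ[ℂ] V →ₗ[ℂ] ℂ := fun o => Matrix.toLinearMap₂' ℂ (a o + (a o)ᵀ)
  have hb : ∀ o (x y : V), b o x y = x ⬝ᵥ ((a o + (a o)ᵀ) *ᵥ y) := fun o x y =>
    Matrix.toLinearMap₂'_apply' _ _ _
  have hne : ∃ x : V, x ≠ 0 := by
    exact ⟨fun _ => 1, fun h => one_ne_zero (congrFun h ((⟨0, hn⟩ : Fin n), (⟨0, hn⟩ : Fin n)))⟩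
  have hyp : ∀ x : V, x ≠ 0 → ∃ y : V, y ≠ 0 ∧ ∀ o, b o x y = 0 := by
    intro x _
    obtain ⟨ξ, hξ, h⟩ := hker x
    refine ⟨ξ, hξ, fun o => ?_⟩
    rw [hb]
    -- symmetry of `a + aᵀ`: `x ⬝ᵥ (S ξ) = (S x) ⬝ᵥ ξ`
    have hsym : ((a o + (a o)ᵀ))ᵀ = a o + (a o)ᵀ := by
      rw [transpose_add, transpose_transpose, add_comm]
    rw [dotProduct_mulVec, ← mulVec_transpose, hsym]
    exact h o
  obtain ⟨x, hx, hxx⟩ := isotropicKernelLemma_all (Module.finrank ℂ V) V le_rfl T b hne hyp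
  refine hx (hiso x fun o => ?_)
  rw [eval_zero_matQuadPoly, eval_matQuadPoly]
  have h2 : x ⬝ᵥ ((a o + (a o)ᵀ) *ᵥ x) = 2 * (x ⬝ᵥ (a o *ᵥ x)) := by
    rw [add_mulVec, dotProduct_add, dotProduct_mulVec x (a o)ᵀ, ← mulVec_transpose,
      transpose_transpose, dotProduct_comm (a o *ᵥ x) x, two_mul]
  have := hxx o
  rw [hb, h2] at this
  exact (mul_eq_zero.mp this).resolve_left two_ne_zero

/-! ## The multiplicity-2 rung: pure quadratic isolated initial forms -/

variable {n : ℕ}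

namespace EqSystem

/-- **Pure QUADRATIC isolated initial forms to order `K` at `x`**: for each test an order `m_o ≤ K` at
which the weighted component of the shifted test is a quadratic form `⟨a_o f, f⟩` in the generators,
the quadrics `a_o` having no common nonzero zero. -/
def PureQuadIsolatedAt (E : EqSystem n) (K : ℕ) (x : GraphVars n → ℂ) : Prop :=
  ∃ (m : Fin E.tests.length → ℕ)
    (a : Fin E.tests.length → Matrix (Fin n × Fin n) (Fin n × Fin n) ℂ),
    (∀ o, m o ≤ K) ∧
    (∀ o, weightedHomogeneousComponent (gw n) (m o)
        (bind₁ (shift x) (E.testPoly (E.tests.get o))) = aeval (generator n) (matQuadPoly (a o))) ∧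
    (∀ F₀ : Fin n × Fin n → ℂ, (∀ o, F₀ ⬝ᵥ (a o *ᵥ F₀) = 0) → F₀ = 0)

/-- Pure quadratic isolated ⇒ pure isolated. -/
theorem pureIsolatedAt_of_pureQuadIsolatedAt {E : EqSystem n} {K : ℕ} {x : GraphVars n → ℂ}
    (h : E.PureQuadIsolatedAt K x) : E.PureIsolatedAt K x := by
  obtain ⟨m, a, hm, hinit, hiso⟩ := h
  refine ⟨m, fun o => matQuadPoly (a o), hm, hinit, fun F₀ hF₀ => hiso F₀ fun o => ?_⟩
  have := hF₀ o
  rwa [eval_zero_matQuadPoly, eval_matQuadPoly] at this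

/-- **Pure quadratic isolated ⇒ initial-form nondegenerate** (unconditionally: the quadratic case of
`IsolatedForcesRank` is a theorem). -/
theorem initNondegAt_of_pureQuadIsolatedAt {E : EqSystem n} {K : ℕ} {x : GraphVars n → ℂ}
    (h : E.PureQuadIsolatedAt K x) : E.InitNondegAt K x := by
  obtain ⟨m, a, hm, hinit, hiso⟩ := h
  obtain ⟨γ, hγ⟩ := isolatedForcesRank_matQuadPoly n E.tests.length a fun F₀ hF₀ =>
    hiso F₀ fun o => by
      have := hF₀ o
      rwa [eval_zero_matQuadPoly, eval_matQuadPoly] at this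
  exact ⟨m, fun o => matQuadPoly (a o), γ, hm, hinit, hγ⟩

/-- **Rank bound at multiplicity 2**: `R(⟨n,n,n⟩) ≤ 2K²·cost`. -/
theorem tensorRank_le_of_pureQuadIsolatedAt {E : EqSystem n} (hE : E.circuit.IsFanInTwo) {K : ℕ}
    {x : GraphVars n → ℂ} (h : E.PureQuadIsolatedAt K x) :
    tensorRank (matMulTensor ℂ n n n) ≤ 2 * (K * K * E.cost) :=
  tensorRank_le_of_initNondegAt hE (initNondegAt_of_pureQuadIsolatedAt h)

end EqSystem

/-- `EqAdmissiblePureQuad β`: correct systems of cost `O(n^β)` with pure quadratic isolated initial forms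
of a bounded order at some point of the graph exist for all `n ≥ 1`. -/
def EqAdmissiblePureQuad (β : ℝ) : Prop :=
  ∃ (K : ℕ) (c : ℝ), ∀ n : ℕ, 1 ≤ n → ∃ E : EqSystem n, E.Correct ∧
    (∃ x ∈ mmGraph n, E.PureQuadIsolatedAt K x) ∧ (E.cost : ℝ) ≤ c * (n : ℝ) ^ β

/-- `EqAdmissiblePureQuad β → EqAdmissibleInit β`. -/
theorem eqAdmissibleInit_of_pureQuad {β : ℝ} (h : EqAdmissiblePureQuad β) : EqAdmissibleInit β := by
  obtain ⟨K, c, hc⟩ := h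
  refine ⟨K, c, fun n hn => ?_⟩
  obtain ⟨E, hE, ⟨x, hx, hq⟩, hcost⟩ := hc n hn
  exact ⟨E, hE, ⟨x, hx, EqSystem.initNondegAt_of_pureQuadIsolatedAt hq⟩, hcost⟩

/-- `EqAdmissiblePureQuad β → EqAdmissiblePure β`. -/
theorem eqAdmissiblePure_of_pureQuad {β : ℝ} (h : EqAdmissiblePureQuad β) : EqAdmissiblePure β := by
  obtain ⟨K, c, hc⟩ := h
  refine ⟨K, c, fun n hn => ?_⟩
  obtain ⟨E, hE, ⟨x, hx, hq⟩, hcost⟩ := hc n hn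
  exact ⟨E, hE, ⟨x, hx, EqSystem.pureIsolatedAt_of_pureQuadIsolatedAt hq⟩, hcost⟩

/-- **THE MULTIPLICITY-2 RUNG.**  Cheap correct systems with pure quadratic isolated initial forms of
bounded order force `ω ≤ β` — unconditionally. -/
theorem omega_le_of_eqAdmissiblePureQuad {β : ℝ} (h : EqAdmissiblePureQuad β) : omega ℂ ≤ β :=
  omega_le_of_eqAdmissibleInit (eqAdmissibleInit_of_pureQuad h)

end Summit.MatrixMultiplication.MatrixMultiplication.Theorems.GraphEquations
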